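import Literature.MathematicalPhysics.QuantumFieldTheory.Balaban1983to89.B9Eq323KatoDomination

/-!
# `Balaban1983to89.B9Eq323KatoCutoffCommutator` — T. Bałaban, *Propagators for lattice gauge theories in a background field*, Commun. Math. Phys. **99** (1985)
# 389–434 [Balaban1985BackgroundPropagators] (3.23) p. 394 (the covariant Laplace operator `Δ^η_U = D*_U D_U`), (3.43) p. 398 (the localised rows of Thm 3.1 with a
# cutoff `ζ ∈ C₀^∞(Δ̃(y))`): **THE CUTOFF COMMUTATOR OF THE KATO-FORM COVARIANT SITE OPERATOR — for a SCALAR cutoff `χ`,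
# `[Δ^η_U, χ]f(x) = (Σ_μ η⁻²(2χ(x) − χ(x+e_μ) − χ(x−e_μ)))·f(x) − Σ_μ [η⁻¹(χ(x+e_μ) − χ(x))·(D_U f)(x, μ) + η⁻¹(χ(x) − χ(x−e_μ))·R(U(x−e_μ, μ))⁻¹(D_U f)(x−e_μ, μ)]`:
# a SECOND difference quotient of `χ` against `f(x)` and FIRST difference quotients of `χ` against COVARIANT DERIVATIVES of `f` — NO monomial `η⁻¹·χ′·f`
# survives the forward∕backward slot pairing — hence `‖[Δ^η_U, χ]f(x)‖ ≤ d(c∕r²)‖f(x)‖ + 2d(c∕r)·M` for a cutoff of width `r` and covariant derivatives `≤ M`,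
# level-free** — the (CO) letter of «storey J» (the ∇-row of Thm 3.1 (3.42) by a contraction in a weighted sup norm) of the NE9 chain, in the vocabulary of
# `B9Eq323KatoDomination` (abstract Kato form §1; the chain's `covLaplaceSiteK` §3)

statement-level skeleton of published theorems with citation tags; proofs where landed; nothing here is a claim about the Yang–Mills mass gap

CITATION HEADER (lean-in-tree rule).  Audit cell `pub-balaban`, sub-cell `t4`, BINDER row NE9; filed by NE9 crux-team LEAF PROVER 05
(`b2b-balaban-t4-ne9-formalise-leaf-05`, gen 82).  MATHEMATICS: t4-ne9-idea-1 (NE9 crux ideation lens 1), gen 124 `t4/ideate/NE9/lens1-g124/PJ2B-PROOF-g124.md` §§1–2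
(certificate `PJ2B_skeleton_g124.NOT-TO-FILE.lean` 728408e469c680aa: `commutator_raw`, `commutator_paired(_sum)`, `backward_transport`, `commutator_kato_paired`,
`norm_commutator_le(_budget)`) — credit theirs; ported here to the tree's Kato form and INSTANTIATED on the chain's (3.23) `B11Eq103H1Complex.covLaplaceSiteK` through
`B9Eq323KatoDomination.equiv_covLaplaceSiteK_eq_sum`, with the first-order terms named as the chain's covariant derivative `covDerivL2K` ((3.3)).  SOURCE READ
first-hand in the held text layer [Balaban1985BackgroundPropagators] (`paper:balaban1985-cmp99-background-propagators`, journal page = PDF page + 388): p. 394 (3.23)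
*«Δ^η_U = D*_U D_U»*; p. 391 (3.3) *«(D^η_{U}λ)(b) = η⁻¹(R(U(b))λ(b₊) − λ(b₋))»*; p. 398 (3.43) *«‖ζ∇_U G′(U)λ‖_β, ‖ζG′(U)∇*_Uλ‖_β ≤ B₀(β)(…)e^{−δ₀d(y,y′)}»* with
*«ζ ∈ C₀^∞(Δ̃(y))»* — print LOCALISES the rows of Thm 3.1 with smooth cutoffs; its engine (p. 398 *«a random walk representation similar to that in (2.40)»*) is NOT
reproduced.  The identity is the lattice form of the textbook Leibniz rule `[−Δ_A, χ]u = (−Δχ)u − 2∇χ·∇_A u` (METHOD only; [folklore]); nothing printed is a hypothesis.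

WHY THIS FILE (cell context).  Storey J (t4-ne9-idea-1 gens 111–135; interface sheet `lens1-g121/NABLA-ROW-STOREY-J-INTERFACE-g121.md` §2 (CO)) bounds the
covariant-gradient row of `G′(U)` by a fixed point in a weighted sup norm (`B9Eq342GradientRowBootstrap`); per output bond it localises with a cutoff `χ` of width
`r` on a ball where print's regularity condition (3.35) p. 396 supplies a comparison pure gauge, and moves `χ` through the resolvent: `χG − Gχ = G[Δ, χ]G`.  The NAIVE
commutator (`commutator_raw`: one difference of `χ` per slot against weight `η⁻²`) costs `η⁻¹‖∇χ‖_∞` against the value row — fatal as `η → 0`.  PAIRING the forward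
slot `(μ,+)` with the backward slot `(μ,−)` and reading both first-order terms as covariant derivatives (the backward one parallel-transported by the contraction
`S = R⁻¹`) removes every `η⁻¹·χ′·f` monomial: the cutoff then costs `c∕r²` against the VALUE row and `2d·c∕r` against the ∇-row, uniformly in `η ≤ r` — the
`2c_χ∕r` part of storey J's contraction constant `θ = S·(2c_χ∕r + 2d·a)`.

WHAT IS PROVED (sorry-free; 0 `def`; [folklore]).
* §1 ABSTRACT KATO FORM (as `B9Eq323KatoDomination` §1: sites `ι`, slots `J`, `nbr : ι → J → ι`, weights `w : ι → J → 𝕜`, transporters `T x j : V →ₗ[𝕜] V`, any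
  commutative ring `𝕜`): **`commutator_raw`** `L(χu)(x) − χ(x)•(Lu)(x) = Σ_j (w x j·(χ x − χ(nbr x j)))•T x j (u(nbr x j))`; **`commutator_paired`** (one direction:
  `t²(χ₀−χ₊)•R₊u₊ + t²(χ₀−χ₋)•R₋u₋ = (t²(2χ₀−χ₊−χ₋))•u₀ − (t(χ₊−χ₀))•(t•(R₊u₊ − u₀)) − (t(χ₀−χ₋))•(t•(u₀ − R₋u₋))`), **`commutator_paired_sum`**;
  **`backward_transport`** (`S(Rv) = v ⟹ S(t•(R u₀ − u₋)) = t•(u₀ − S u₋)`); **`commutator_kato_paired`** (slots `Fin d ⊕ Fin d`, constant weight `t²`).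
  SIZES over a normed field: **`norm_commutator_le`**, **`norm_backward_le`** (`‖S v‖ ≤ ‖v‖`), **`norm_commutator_le_budget`**
  (`≤ d(c∕r²)‖u₀‖ + 2d(c∕r)M` under `‖t(χ₊−χ₀)‖, ‖t(χ₀−χ₋)‖ ≤ c∕r`, `‖t²(2χ₀−χ₊−χ₋)‖ ≤ c∕r²`, covariant derivatives `≤ M`).
* §2 THE CHAIN's (3.23): for `covLaplaceSiteK (t:𝕜) R S` on `SiteL2K 𝕜 d Pd c₀ W` with `S b (R b w) = w`, a REAL cutoff `χ : TSite d Pd → ℝ` and ANY `g` with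
  `g(y) = χ(y)•f(y)` pointwise (`hg`; no `def`): **`equiv_covLaplaceSiteK_cutoff_sub`** — the displayed identity with `(D_R f) = WL2.equiv (covDerivL2K 𝕜 c₀ t R f)` BY
  NAME; **`norm_equiv_covLaplaceSiteK_cutoff_sub_le`** — `‖(Δg)(x) − χ(x)•(Δf)(x)‖ ≤ d(c∕r²)‖f(x)‖ + 2d(c∕r)M` under `|t(χ(x+e_μ)−χ(x))|, |t(χ(x)−χ(x−e_μ))| ≤ c∕r`,
  `|t²(2χ(x)−χ(x+e_μ)−χ(x−e_μ))| ≤ c∕r²`, `‖(D_R f)(x,μ)‖, ‖(D_R f)(x−e_μ,μ)‖ ≤ M`, `‖S b w‖ ≤ ‖w‖` — at ONE site `x` (the consumer quantifies).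
* §3 (v1.1, APPEND-ONLY; leaf-05 gen 84) **`norm_equiv_covLaplaceSiteK_cutoff_sub_le_natural`** — the NATURAL form of §2's budget, no a-priori `M`:
  `‖(Δg)(x) − χ(x)•(Δf)(x)‖ ≤ d(c∕r²)‖f(x)‖ + (c∕r)·Σ_μ(‖(D_R f)(x,μ)‖ + ‖(D_R f)(x−e_μ,μ)‖)` — the stencil shape consumed by
  `B9Eq342GradientRowNaturalPerturbation.pert_of_natural_bond` (`ε^nat = c∕r`).
HONEST SCOPE.  Lattice algebra + triangle inequality; (h1) for a SHARP indicator `χ = 1_Ω` the second difference quotient is `∼ t²` on `∂Ω` and §2 buys nothing —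
(CO) is a statement about lattice-Lipschitz cutoffs (`t|χ₊ − χ₀| ≤ c∕r`), which is how print localises ((3.43), (3.46)); (h2) pointwise only — turning it into a
weighted-row statement for `G′(U)[Δ^η_U, χ]G′(U)` needs the (K∇) letter (`B5Eq129FreeResolventGradientRow` & co.) and the value row; (h3) `M` is whatever a-priori
covariant-gradient bound the context supplies; (h4) the averaging penalty `a′Q′*Q′` of (3.24) is NOT of Kato form and is not treated here.  ONE letter of ONE
un-opened storey (J) of row L13 of `t4/ROUTES-NE9.md`; nothing of Bałaban's asserted.  NOT summit progress (cell pub-balaban: NE9 NOT PRINTED ∕ NOT PROVED; «NE9 ⇐ the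
named binders»; row WALLED ON A MODEL (O-NE9-1; #5 UNRULED); spine PROVED 0∕9; rung (B)+1 finite T⁴ — NOT infinite volume, NOT mass gap, NOT BetaPertH, NOT Clay).
HONEST DEPENDENCY (cell line): continuum YM on T⁴ ⇐ BetaPertH ∧ nine spine estimates (0/9 proved); BetaPertH ⇐ (D1) ∧ (D4) ∧ CAP+tail; G-an2-4 gates asym, D1 and
NE2/3/4.  NEW file importing `B9Eq323KatoDomination` only; nothing modified.  Net new unproved facts: 0.
-/

noncomputable section

open scoped BigOperators

namespace Literature.MathematicalPhysics.QuantumFieldTheory.Balaban1983to89.B9Eq323KatoCutoffCommutator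

open B4Sect5Torus (TSite)
open B9SectCLatticeCarrier (Bond shift unshift shift_unshift)
open B9Eq33CovDerivVector (covDeriv covDeriv_apply_dir)
open B9Eq311L2Pairing (WL2)
open B11Eq103H1Complex (SiteL2K covLaplaceSiteK covDerivL2K equiv_covDerivL2K)
open B9Eq323KatoDomination (equiv_covLaplaceSiteK_eq_sum)

/-! ## §1 The cutoff commutator in abstract Kato form: raw, paired, sizes -/

section Algebra

variable {𝕜 : Type*} [CommRing 𝕜] {V : Type*} [AddCommGroup V] [Module 𝕜 V] {ι J : Type*} [Fintype J]

/-- **(CO-raw)** in the Kato form of `B9Eq323KatoDomination` §1: for `(L u)(x) = Σ_j (w x j)•(u x − T x j (u (nbr x j)))` and a scalar cutoff `χ`,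
`L(χu)(x) − χ(x)•(Lu)(x) = Σ_j (w x j·(χ x − χ(nbr x j)))•T x j (u(nbr x j))` — ONE difference of `χ` per slot (with `w = η⁻²` a factor `η⁻¹` is still visible
against `u`).  (t4-ne9-idea-1 g124 `commutator_raw`.) [folklore] [cite: Balaban1985BackgroundPropagators, (3.23) p.394] -/
theorem commutator_raw (nbr : ι → J → ι) (w : ι → J → 𝕜) (T : ι → J → V →ₗ[𝕜] V) (χ : ι → 𝕜) (u : ι → V) (x : ι) :
    (∑ j, w x j • (χ x • u x - T x j (χ (nbr x j) • u (nbr x j)))) - χ x • (∑ j, w x j • (u x - T x j (u (nbr x j)))) =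
      ∑ j, (w x j * (χ x - χ (nbr x j))) • T x j (u (nbr x j)) := by
  rw [Finset.smul_sum, ← Finset.sum_sub_distrib]
  refine Finset.sum_congr rfl fun j _ => ?_
  rw [map_smul]
  module

/-- **(CO-paired), one direction**: forward slot (neighbour `x+e_μ`, transporter `R₊`, values `u₊`) paired with the backward slot (`x−e_μ`, `R₋`, `u₋`), weight `t²`:
`t²(χ₀−χ₊)•R₊u₊ + t²(χ₀−χ₋)•R₋u₋ = (t²(2χ₀−χ₊−χ₋))•u₀ − (t(χ₊−χ₀))•(t•(R₊u₊ − u₀)) − (t(χ₀−χ₋))•(t•(u₀ − R₋u₋))` — a second difference of `χ` against `u₀`,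
first differences of `χ` against the (transported) covariant derivatives; NO `t·χ′·u` monomial.  (g124 `commutator_paired`.) [folklore]
[cite: Balaban1985BackgroundPropagators, (3.23) p.394, (3.3) p.391] -/
theorem commutator_paired (t χ₀ χp χm : 𝕜) (u₀ up um : V) (Rp Rm : V →ₗ[𝕜] V) :
    (t ^ 2 * (χ₀ - χp)) • Rp up + (t ^ 2 * (χ₀ - χm)) • Rm um =
      (t ^ 2 * (2 * χ₀ - χp - χm)) • u₀ - (t * (χp - χ₀)) • (t • (Rp up - u₀)) - (t * (χ₀ - χm)) • (t • (u₀ - Rm um)) := by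
  module

/-- **(CO-paired), summed over the `d` directions.** (g124 `commutator_paired_sum`.) [folklore] [cite: Balaban1985BackgroundPropagators, (3.23) p.394] -/
theorem commutator_paired_sum {d : ℕ} (t χ₀ : 𝕜) (χp χm : Fin d → 𝕜) (u₀ : V) (up um : Fin d → V) (Rp Rm : Fin d → V →ₗ[𝕜] V) :
    (∑ μ, ((t ^ 2 * (χ₀ - χp μ)) • Rp μ (up μ) + (t ^ 2 * (χ₀ - χm μ)) • Rm μ (um μ))) =
      (∑ μ, t ^ 2 * (2 * χ₀ - χp μ - χm μ)) • u₀ -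
        ∑ μ, ((t * (χp μ - χ₀)) • (t • (Rp μ (up μ) - u₀)) + (t * (χ₀ - χm μ)) • (t • (u₀ - Rm μ (um μ)))) := by
  rw [Finset.sum_smul, ← Finset.sum_sub_distrib]
  refine Finset.sum_congr rfl fun μ _ => ?_
  rw [commutator_paired]
  abel

/-- **The transported backward derivative**: `S(R v) = v` for all `v` gives `S(t•(R u₀ − u₋)) = t•(u₀ − S u₋)` — the backward first-order term `t•(u₀ − R₋u₋)` IS
the covariant derivative on the bond `(x−e_μ, μ)` transported to `x` by `S = R⁻¹`.  (g124 `backward_transport`.) [folklore] [cite: Balaban1985BackgroundPropagators, (3.3) p.391] -/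
theorem backward_transport (t : 𝕜) (R S : V →ₗ[𝕜] V) (hSR : ∀ v, S (R v) = v) (u₀ um : V) : S (t • (R u₀ - um)) = t • (u₀ - S um) := by
  rw [map_smul, map_sub, hSR]

/-- **(CO) in Kato form with paired slots** `J = Fin d ⊕ Fin d` (`inl μ` forward, `inr μ` backward), constant weight `t²`:
`L(χu)(x) − χ(x)•(Lu)(x) = (Σ_μ t²(2χ(x) − χ(x₊μ) − χ(x₋μ)))•u(x) − Σ_μ [t(χ(x₊μ)−χ(x))•D₊μ + t(χ(x)−χ(x₋μ))•D₋μ]` with `D₊μ = t•(T x (inl μ) u(x₊μ) − u x)`,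
`D₋μ = t•(u x − T x (inr μ) u(x₋μ))`.  (g124 `commutator_kato_paired`.) [folklore] [cite: Balaban1985BackgroundPropagators, (3.23) p.394] -/
theorem commutator_kato_paired {d : ℕ} (nbr : ι → (Fin d ⊕ Fin d) → ι) (t : 𝕜) (T : ι → (Fin d ⊕ Fin d) → V →ₗ[𝕜] V) (χ : ι → 𝕜) (u : ι → V) (x : ι) :
    (∑ j, t ^ 2 • (χ x • u x - T x j (χ (nbr x j) • u (nbr x j)))) - χ x • (∑ j, t ^ 2 • (u x - T x j (u (nbr x j)))) =
      (∑ μ : Fin d, t ^ 2 * (2 * χ x - χ (nbr x (.inl μ)) - χ (nbr x (.inr μ)))) • u x -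
        ∑ μ : Fin d, ((t * (χ (nbr x (.inl μ)) - χ x)) • (t • (T x (.inl μ) (u (nbr x (.inl μ))) - u x)) +
          (t * (χ x - χ (nbr x (.inr μ)))) • (t • (u x - T x (.inr μ) (u (nbr x (.inr μ)))))) := by
  rw [commutator_raw nbr (fun _ _ => t ^ 2) T χ u x, Fintype.sum_sum_type, ← Finset.sum_add_distrib]
  exact commutator_paired_sum t (χ x) (fun μ => χ (nbr x (.inl μ))) (fun μ => χ (nbr x (.inr μ))) (u x)
    (fun μ => u (nbr x (.inl μ))) (fun μ => u (nbr x (.inr μ))) (fun μ => T x (.inl μ)) (fun μ => T x (.inr μ))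

end Algebra

section Size

variable {𝕜 : Type*} [NormedField 𝕜] {V : Type*} [SeminormedAddCommGroup V] [NormedSpace 𝕜 V]

/-- **SIZES of (CO)**: the triangle inequality on `commutator_paired_sum`. (g124 `norm_commutator_le`.) [folklore] [cite: Balaban1985BackgroundPropagators, (3.23) p.394] -/
theorem norm_commutator_le {d : ℕ} (t χ₀ : 𝕜) (χp χm : Fin d → 𝕜) (u₀ : V) (up um : Fin d → V) (Rp Rm : Fin d → V →ₗ[𝕜] V) :
    ‖∑ μ, ((t ^ 2 * (χ₀ - χp μ)) • Rp μ (up μ) + (t ^ 2 * (χ₀ - χm μ)) • Rm μ (um μ))‖ ≤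
      (∑ μ, ‖t ^ 2 * (2 * χ₀ - χp μ - χm μ)‖) * ‖u₀‖ +
        ∑ μ, (‖t * (χp μ - χ₀)‖ * ‖t • (Rp μ (up μ) - u₀)‖ + ‖t * (χ₀ - χm μ)‖ * ‖t • (u₀ - Rm μ (um μ))‖) := by
  rw [commutator_paired_sum]
  refine (norm_sub_le _ _).trans (add_le_add ?_ ?_)
  · rw [Finset.sum_smul, Finset.sum_mul]
    refine (norm_sum_le _ _).trans (Finset.sum_le_sum fun μ _ => ?_)
    rw [norm_smul]
  · refine (norm_sum_le _ _).trans (Finset.sum_le_sum fun μ _ => ?_)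
    refine (norm_add_le _ _).trans (add_le_add ?_ ?_) <;> rw [norm_smul]

/-- **The transported backward derivative is no larger than the backward derivative** when the transporter `S` is a contraction:
`‖t•(u₀ − S u₋)‖ = ‖S(t•(R u₀ − u₋))‖ ≤ ‖t•(R u₀ − u₋)‖`. (g124 `norm_backward_le`.) [folklore] [cite: Balaban1985BackgroundPropagators, (3.3) p.391] -/
theorem norm_backward_le (t : 𝕜) (R S : V →ₗ[𝕜] V) (hSR : ∀ v, S (R v) = v) (hS : ∀ v, ‖S v‖ ≤ ‖v‖) (u₀ um : V) :
    ‖t • (u₀ - S um)‖ ≤ ‖t • (R u₀ - um)‖ := by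
  rw [← backward_transport t R S hSR u₀ um]
  exact hS _

/-- **BUDGET form of (CO)**: with a cutoff profile `‖t(χ₊−χ₀)‖, ‖t(χ₀−χ₋)‖ ≤ c∕r` (first difference quotients), `‖t²(2χ₀−χ₊−χ₋)‖ ≤ c∕r²` (second difference
quotient) in every direction, covariant derivatives bounded by `M` (forward on `(x, μ)`: `t•(R₊u₊ − u₀)`; on `(x−e_μ, μ)`: `t•(R u₀ − u₋)` with `R` the transporter
there), and backward transporters `Rm μ` that invert `R μ` and contract: `‖[L,χ]u(x)‖ ≤ d·(c∕r²)·‖u₀‖ + 2d·(c∕r)·M` — level-free, no `t = η⁻¹` left.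
(g124 `norm_commutator_le_budget`.) [folklore] [cite: Balaban1985BackgroundPropagators, (3.23) p.394, (3.43) p.398] -/
theorem norm_commutator_le_budget {d : ℕ} (t χ₀ : 𝕜) (χp χm : Fin d → 𝕜) (u₀ : V) (up um : Fin d → V) (Rp Rm R : Fin d → V →ₗ[𝕜] V)
    (hSR : ∀ μ v, Rm μ (R μ v) = v) (hS : ∀ μ v, ‖Rm μ v‖ ≤ ‖v‖) {c r M : ℝ} (hcr : 0 ≤ c / r)
    (h1p : ∀ μ, ‖t * (χp μ - χ₀)‖ ≤ c / r) (h1m : ∀ μ, ‖t * (χ₀ - χm μ)‖ ≤ c / r) (h2 : ∀ μ, ‖t ^ 2 * (2 * χ₀ - χp μ - χm μ)‖ ≤ c / r ^ 2)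
    (hDp : ∀ μ, ‖t • (Rp μ (up μ) - u₀)‖ ≤ M) (hDm : ∀ μ, ‖t • (R μ u₀ - um μ)‖ ≤ M) :
    ‖∑ μ, ((t ^ 2 * (χ₀ - χp μ)) • Rp μ (up μ) + (t ^ 2 * (χ₀ - χm μ)) • Rm μ (um μ))‖ ≤ d * (c / r ^ 2) * ‖u₀‖ + 2 * d * (c / r) * M := by
  refine (norm_commutator_le t χ₀ χp χm u₀ up um Rp Rm).trans (add_le_add ?_ ?_)
  · refine mul_le_mul_of_nonneg_right ?_ (norm_nonneg _)
    calc (∑ μ, ‖t ^ 2 * (2 * χ₀ - χp μ - χm μ)‖) ≤ ∑ _μ : Fin d, c / r ^ 2 := Finset.sum_le_sum fun μ _ => h2 μ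
      _ = d * (c / r ^ 2) := by simp
  · calc (∑ μ, (‖t * (χp μ - χ₀)‖ * ‖t • (Rp μ (up μ) - u₀)‖ + ‖t * (χ₀ - χm μ)‖ * ‖t • (u₀ - Rm μ (um μ))‖))
        ≤ ∑ _μ : Fin d, (c / r * M + c / r * M) := by
          refine Finset.sum_le_sum fun μ _ => add_le_add ?_ ?_
          · exact mul_le_mul (h1p μ) (hDp μ) (norm_nonneg _) hcr
          · exact mul_le_mul (h1m μ) ((norm_backward_le t (R μ) (Rm μ) (hSR μ) (hS μ) u₀ (um μ)).trans (hDm μ)) (norm_nonneg _) hcr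
      _ = 2 * d * (c / r) * M := by simp; ring

end Size

/-! ## §2 The chain's covariant Laplace operator (3.23) against a real cutoff -/

section Lattice

variable {𝕜 : Type*} [RCLike 𝕜] {d : ℕ} {Pd : Fin d → ℕ} {W : Type*} [NormedAddCommGroup W] [InnerProductSpace 𝕜 W]
  {c₀ : ℝ} [Fact (0 < c₀)]

/-- **THE CUTOFF COMMUTATOR OF (3.23), POINTWISE.**  Transporter data with `S(b)R(b) = 1`, a real difference quotient `t` (= η⁻¹), a REAL cutoff `χ` on the sites and
any `g` with `g(y) = χ(y)•f(y)` for all `y`.  Then at every site `x`, writing `(D f)(y, μ) = t•(R(y,μ)f(y+e_μ) − f(y))` for the chain's covariant derivative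
`covDerivL2K 𝕜 c₀ t R f` ((3.3)):
`(Δ^η_U g)(x) − χ(x)•(Δ^η_U f)(x) = (Σ_μ t²(2χ(x) − χ(x+e_μ) − χ(x−e_μ)))•f(x) − Σ_μ [t(χ(x+e_μ) − χ(x))•(D f)(x,μ) + t(χ(x) − χ(x−e_μ))•S(x−e_μ,μ)(D f)(x−e_μ,μ)]`.
Proof: `equiv_covLaplaceSiteK_eq_sum` for `g` and `f`, `commutator_paired` per direction, `backward_transport` on the bond `(x−e_μ, μ)`. [folklore]
[cite: Balaban1985BackgroundPropagators, (3.23) p.394, (3.3) p.391, (3.43) p.398] -/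
theorem equiv_covLaplaceSiteK_cutoff_sub (t : ℝ) (R S : Bond d Pd → W →ₗ[𝕜] W) (hSR : ∀ b w, S b (R b w) = w) (f g : SiteL2K 𝕜 d Pd c₀ W)
    (χ : TSite d Pd → ℝ) (hg : ∀ y, WL2.equiv 𝕜 _ W g y = ((χ y : ℝ) : 𝕜) • WL2.equiv 𝕜 _ W f y) (x : TSite d Pd) :
    WL2.equiv 𝕜 _ W (covLaplaceSiteK (t : 𝕜) R S g) x - ((χ x : ℝ) : 𝕜) • WL2.equiv 𝕜 _ W (covLaplaceSiteK (t : 𝕜) R S f) x =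
      (∑ μ, ((t ^ 2 * (2 * χ x - χ (shift μ x) - χ (unshift μ x)) : ℝ) : 𝕜)) • WL2.equiv 𝕜 _ W f x -
        ∑ μ, ((((t * (χ (shift μ x) - χ x)) : ℝ) : 𝕜) • WL2.equiv 𝕜 _ W (covDerivL2K 𝕜 c₀ (t : 𝕜) R f) (x, μ) +
          (((t * (χ x - χ (unshift μ x))) : ℝ) : 𝕜) • S (unshift μ x, μ) (WL2.equiv 𝕜 _ W (covDerivL2K 𝕜 c₀ (t : 𝕜) R f) (unshift μ x, μ))) := by
  set F := WL2.equiv 𝕜 _ W f with hF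
  have hD : ∀ y μ, WL2.equiv 𝕜 _ W (covDerivL2K 𝕜 c₀ (t : 𝕜) R f) (y, μ) = (t : 𝕜) • (R (y, μ) (F (shift μ y)) - F y) := fun y μ => by
    rw [equiv_covDerivL2K, covDeriv_apply_dir]
  have hback : ∀ μ, S (unshift μ x, μ) (WL2.equiv 𝕜 _ W (covDerivL2K 𝕜 c₀ (t : 𝕜) R f) (unshift μ x, μ)) =
      (t : 𝕜) • (F x - S (unshift μ x, μ) (F (unshift μ x))) := fun μ => by
    rw [hD, shift_unshift, backward_transport (t : 𝕜) (R (unshift μ x, μ)) (S (unshift μ x, μ)) (hSR _) (F x) (F (unshift μ x))]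
  rw [equiv_covLaplaceSiteK_eq_sum t R S hSR g x, equiv_covLaplaceSiteK_eq_sum t R S hSR f x, Finset.smul_sum, ← Finset.sum_sub_distrib,
    Finset.sum_smul, ← Finset.sum_sub_distrib]
  refine Finset.sum_congr rfl fun μ _ => ?_
  rw [hback μ, hD x μ, hg x, hg (unshift μ x), hg (shift μ x), map_smul, map_smul]
  push_cast
  module

/-- **THE CUTOFF COMMUTATOR OF (3.23), BUDGET.**  If moreover the backward transporters contract (`‖S(b)w‖ ≤ ‖w‖`), the cutoff has width `r` at `x` in lattice
units of `t⁻¹` — `|t(χ(x+e_μ) − χ(x))|, |t(χ(x) − χ(x−e_μ))| ≤ c∕r` and `|t²(2χ(x) − χ(x+e_μ) − χ(x−e_μ))| ≤ c∕r²` for every `μ` (`0 ≤ c∕r`) — and the covariant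
derivatives of `f` on the `2d` bonds at `x` are `≤ M`, then `‖(Δ^η_U g)(x) − χ(x)•(Δ^η_U f)(x)‖ ≤ d·(c∕r²)·‖f(x)‖ + 2d·(c∕r)·M`: the cutoff costs `r⁻²` against the
value and `r⁻¹` against the covariant gradient, uniformly in `η` — the `2c_χ∕r` part of storey J's contraction constant. [folklore]
[cite: Balaban1985BackgroundPropagators, (3.23) p.394, (3.43) p.398] -/
theorem norm_equiv_covLaplaceSiteK_cutoff_sub_le (t : ℝ) (R S : Bond d Pd → W →ₗ[𝕜] W) (hSR : ∀ b w, S b (R b w) = w) (hS : ∀ b w, ‖S b w‖ ≤ ‖w‖)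
    (f g : SiteL2K 𝕜 d Pd c₀ W) (χ : TSite d Pd → ℝ) (hg : ∀ y, WL2.equiv 𝕜 _ W g y = ((χ y : ℝ) : 𝕜) • WL2.equiv 𝕜 _ W f y) (x : TSite d Pd)
    {c r M : ℝ} (hcr : 0 ≤ c / r) (h1p : ∀ μ, |t * (χ (shift μ x) - χ x)| ≤ c / r) (h1m : ∀ μ, |t * (χ x - χ (unshift μ x))| ≤ c / r)
    (h2 : ∀ μ, |t ^ 2 * (2 * χ x - χ (shift μ x) - χ (unshift μ x))| ≤ c / r ^ 2)
    (hDp : ∀ μ, ‖WL2.equiv 𝕜 _ W (covDerivL2K 𝕜 c₀ (t : 𝕜) R f) (x, μ)‖ ≤ M)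
    (hDm : ∀ μ, ‖WL2.equiv 𝕜 _ W (covDerivL2K 𝕜 c₀ (t : 𝕜) R f) (unshift μ x, μ)‖ ≤ M) :
    ‖WL2.equiv 𝕜 _ W (covLaplaceSiteK (t : 𝕜) R S g) x - ((χ x : ℝ) : 𝕜) • WL2.equiv 𝕜 _ W (covLaplaceSiteK (t : 𝕜) R S f) x‖ ≤
      d * (c / r ^ 2) * ‖WL2.equiv 𝕜 _ W f x‖ + 2 * d * (c / r) * M := by
  rw [equiv_covLaplaceSiteK_cutoff_sub t R S hSR f g χ hg x]
  refine (norm_sub_le _ _).trans (add_le_add ?_ ?_)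
  · rw [norm_smul]
    refine mul_le_mul_of_nonneg_right ?_ (norm_nonneg _)
    calc ‖∑ μ, ((t ^ 2 * (2 * χ x - χ (shift μ x) - χ (unshift μ x)) : ℝ) : 𝕜)‖
        ≤ ∑ μ, ‖((t ^ 2 * (2 * χ x - χ (shift μ x) - χ (unshift μ x)) : ℝ) : 𝕜)‖ := norm_sum_le _ _
      _ ≤ ∑ _μ : Fin d, c / r ^ 2 := Finset.sum_le_sum fun μ _ => by
          rw [RCLike.norm_ofReal]
          exact h2 μ
      _ = d * (c / r ^ 2) := by simp
  · calc ‖∑ μ, ((((t * (χ (shift μ x) - χ x)) : ℝ) : 𝕜) • WL2.equiv 𝕜 _ W (covDerivL2K 𝕜 c₀ (t : 𝕜) R f) (x, μ) +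
            (((t * (χ x - χ (unshift μ x))) : ℝ) : 𝕜) • S (unshift μ x, μ) (WL2.equiv 𝕜 _ W (covDerivL2K 𝕜 c₀ (t : 𝕜) R f) (unshift μ x, μ)))‖
        ≤ ∑ μ, (‖(((t * (χ (shift μ x) - χ x)) : ℝ) : 𝕜) • WL2.equiv 𝕜 _ W (covDerivL2K 𝕜 c₀ (t : 𝕜) R f) (x, μ)‖ +
            ‖(((t * (χ x - χ (unshift μ x))) : ℝ) : 𝕜) • S (unshift μ x, μ) (WL2.equiv 𝕜 _ W (covDerivL2K 𝕜 c₀ (t : 𝕜) R f) (unshift μ x, μ))‖) :=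
          (norm_sum_le _ _).trans (Finset.sum_le_sum fun μ _ => norm_add_le _ _)
      _ ≤ ∑ _μ : Fin d, (c / r * M + c / r * M) := by
          refine Finset.sum_le_sum fun μ _ => add_le_add ?_ ?_
          · rw [norm_smul, RCLike.norm_ofReal]
            exact mul_le_mul (h1p μ) (hDp μ) (norm_nonneg _) hcr
          · rw [norm_smul, RCLike.norm_ofReal]
            exact mul_le_mul (h1m μ) ((hS _ _).trans (hDm μ)) (norm_nonneg _) hcr
      _ = 2 * d * (c / r) * M := by simp; ring

end Lattice

/-! ## §3 The NATURAL form of the budget: the covariant derivatives kept bond by bond (storey J's stencil letter) -/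

section Natural

variable {𝕜 : Type*} [RCLike 𝕜] {d : ℕ} {Pd : Fin d → ℕ} {W : Type*} [NormedAddCommGroup W] [InnerProductSpace 𝕜 W]
  {c₀ : ℝ} [Fact (0 < c₀)]

/-- **THE CUTOFF COMMUTATOR OF (3.23), NATURAL BUDGET.**  As `norm_equiv_covLaplaceSiteK_cutoff_sub_le` but WITHOUT the a-priori covariant-gradient bound `M`:
the covariant derivatives of `f` on the `2d` bonds at `x` are kept bond by bond —
`‖(Δ^η_U g)(x) − χ(x)•(Δ^η_U f)(x)‖ ≤ d·(c∕r²)·‖f(x)‖ + (c∕r)·Σ_μ (‖(D f)(x,μ)‖ + ‖(D f)(x−e_μ,μ)‖)` — the STENCIL shape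
`ε^nat·Σ_ν(‖D(y,ν)‖ + ‖D(y−e_ν,ν)‖) + (value term)` consumed by `B9Eq342GradientRowNaturalPerturbation.pert_of_natural_bond` (storey J's perturbation letter
in the weighted currency), with `ε^nat = c∕r`, t-free. [folklore] [cite: Balaban1985BackgroundPropagators, (3.23) p.394, (3.43) p.398] -/
theorem norm_equiv_covLaplaceSiteK_cutoff_sub_le_natural (t : ℝ) (R S : Bond d Pd → W →ₗ[𝕜] W) (hSR : ∀ b w, S b (R b w) = w)
    (hS : ∀ b w, ‖S b w‖ ≤ ‖w‖) (f g : SiteL2K 𝕜 d Pd c₀ W) (χ : TSite d Pd → ℝ)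
    (hg : ∀ y, WL2.equiv 𝕜 _ W g y = ((χ y : ℝ) : 𝕜) • WL2.equiv 𝕜 _ W f y) (x : TSite d Pd)
    {c r : ℝ} (hcr : 0 ≤ c / r) (h1p : ∀ μ, |t * (χ (shift μ x) - χ x)| ≤ c / r) (h1m : ∀ μ, |t * (χ x - χ (unshift μ x))| ≤ c / r)
    (h2 : ∀ μ, |t ^ 2 * (2 * χ x - χ (shift μ x) - χ (unshift μ x))| ≤ c / r ^ 2) :
    ‖WL2.equiv 𝕜 _ W (covLaplaceSiteK (t : 𝕜) R S g) x - ((χ x : ℝ) : 𝕜) • WL2.equiv 𝕜 _ W (covLaplaceSiteK (t : 𝕜) R S f) x‖ ≤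
      d * (c / r ^ 2) * ‖WL2.equiv 𝕜 _ W f x‖ +
        c / r * ∑ μ, (‖WL2.equiv 𝕜 _ W (covDerivL2K 𝕜 c₀ (t : 𝕜) R f) (x, μ)‖ + ‖WL2.equiv 𝕜 _ W (covDerivL2K 𝕜 c₀ (t : 𝕜) R f) (unshift μ x, μ)‖) := by
  rw [equiv_covLaplaceSiteK_cutoff_sub t R S hSR f g χ hg x]
  refine (norm_sub_le _ _).trans (add_le_add ?_ ?_)
  · rw [norm_smul]
    refine mul_le_mul_of_nonneg_right ?_ (norm_nonneg _)
    calc ‖∑ μ, ((t ^ 2 * (2 * χ x - χ (shift μ x) - χ (unshift μ x)) : ℝ) : 𝕜)‖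
        ≤ ∑ μ, ‖((t ^ 2 * (2 * χ x - χ (shift μ x) - χ (unshift μ x)) : ℝ) : 𝕜)‖ := norm_sum_le _ _
      _ ≤ ∑ _μ : Fin d, c / r ^ 2 := Finset.sum_le_sum fun μ _ => by
          rw [RCLike.norm_ofReal]
          exact h2 μ
      _ = d * (c / r ^ 2) := by simp
  · rw [Finset.mul_sum]
    calc ‖∑ μ, ((((t * (χ (shift μ x) - χ x)) : ℝ) : 𝕜) • WL2.equiv 𝕜 _ W (covDerivL2K 𝕜 c₀ (t : 𝕜) R f) (x, μ) +
            (((t * (χ x - χ (unshift μ x))) : ℝ) : 𝕜) • S (unshift μ x, μ) (WL2.equiv 𝕜 _ W (covDerivL2K 𝕜 c₀ (t : 𝕜) R f) (unshift μ x, μ)))‖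
        ≤ ∑ μ, (‖(((t * (χ (shift μ x) - χ x)) : ℝ) : 𝕜) • WL2.equiv 𝕜 _ W (covDerivL2K 𝕜 c₀ (t : 𝕜) R f) (x, μ)‖ +
            ‖(((t * (χ x - χ (unshift μ x))) : ℝ) : 𝕜) • S (unshift μ x, μ) (WL2.equiv 𝕜 _ W (covDerivL2K 𝕜 c₀ (t : 𝕜) R f) (unshift μ x, μ))‖) :=
          (norm_sum_le _ _).trans (Finset.sum_le_sum fun μ _ => norm_add_le _ _)
      _ ≤ ∑ μ, c / r * (‖WL2.equiv 𝕜 _ W (covDerivL2K 𝕜 c₀ (t : 𝕜) R f) (x, μ)‖ +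
            ‖WL2.equiv 𝕜 _ W (covDerivL2K 𝕜 c₀ (t : 𝕜) R f) (unshift μ x, μ)‖) := by
          refine Finset.sum_le_sum fun μ _ => ?_
          rw [mul_add]
          refine add_le_add ?_ ?_
          · rw [norm_smul, RCLike.norm_ofReal]
            exact mul_le_mul_of_nonneg_right (h1p μ) (norm_nonneg _)
          · rw [norm_smul, RCLike.norm_ofReal]
            exact mul_le_mul (h1m μ) (hS _ _) (norm_nonneg _) hcr

end Natural

end Literature.MathematicalPhysics.QuantumFieldTheory.Balaban1983to89.B9Eq323KatoCutoffCommutator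

end
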